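import Summits.CriticalPhenomena.PercolationContinuityZ3.Theorems.PercNearOneGluingNoHeavyLowerTailCertCheck

/-!
# `NoHeavyLowerTail` (stmt-CriticalPhenomena-4575) — certificate machine, part 1b: soundness of the checker

Support file (depth prover nh-dp-blobmono gen 3; `--supports stmt-CriticalPhenomena-4575`).  Continuation of
`…CertCheck.lean` (the computable checker `CertCheck.check` / `CertCheck.checkB` and the values `evalT`, `evalM`,
`linEval`): the values of the expansions `linTerms` / `pairTerms` / `plusTerms` / `minusTerms`, and the soundness
theorems `CertCheck.sound` (one declaration), `CertCheck.sound_of_buckets` (one declaration per bucket — the form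
used for large certificates, since the kernel's memory is per declaration) and `CertCheck.exists_le_of_sound`
(from the weighted sum to one reference).  No named facts, no sorries, standard axioms.
-/

namespace Summit.CriticalPhenomena.PercolationContinuityZ3.Theorems

namespace CertCheck

variable (x : ℕ → ℝ)

/-! ### Values of the expansions -/

/-- Value of the linear expansion. [folklore] -/
theorem evalT_linTerms (e mult : List ℕ) (wt : ℕ) :
    evalT x (linTerms e mult wt) = (wt : ℝ) * evalM x mult * linEval x e := by
  induction e with
  | nil => simp [linTerms, evalT, linEval]
  | cons i e ih =>
    unfold linTerms at ih ⊢
    rw [List.map_cons, evalT_cons, ih]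
    simp only [evalM_monoIns, linEval, List.map_cons, List.sum_cons]
    ring

/-- Value of one slice of the product expansion. [folklore] -/
theorem evalT_map_pair (i : ℕ) (e' mult : List ℕ) (wt : ℕ) :
    evalT x (e'.map fun j => (monoIns i (monoIns j mult), wt)) =
      (wt : ℝ) * evalM x mult * (x i * linEval x e') := by
  induction e' with
  | nil => simp [evalT, linEval]
  | cons j e' ih' =>
    rw [List.map_cons, evalT_cons, ih']
    simp only [evalM_monoIns, linEval, List.map_cons, List.sum_cons]
    ring

/-- Value of the product expansion. [folklore] -/
theorem evalT_pairTerms (e e' mult : List ℕ) (wt : ℕ) :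
    evalT x (pairTerms e e' mult wt) = (wt : ℝ) * evalM x mult * (linEval x e * linEval x e') := by
  induction e with
  | nil => simp [pairTerms, evalT, linEval]
  | cons i e ih =>
    unfold pairTerms at ih ⊢
    rw [List.flatMap_cons, evalT_append, ih, evalT_map_pair]
    simp only [linEval, List.map_cons, List.sum_cons]
    ring

/-- Value of a `flatMap` of term lists. [folklore] -/
theorem evalT_flatMap {β : Type*} (l : List β) (f : β → List Term) :
    evalT x (l.flatMap f) = (l.map fun b => evalT x (f b)).sum := by
  induction l with
  | nil => simp
  | cons b l ih => rw [List.flatMap_cons, evalT_append, ih, List.map_cons, List.sum_cons]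

/-- Value of the plus side. [folklore] -/
theorem evalT_plusTerms (L : List ℕ) (rows : List Row) (al : List ATerm) :
    evalT x (plusTerms L rows al) =
      (al.map fun a => (a.wt : ℝ) * evalM x a.mult * linEval x L).sum +
        (rows.map fun r => (r.wt : ℝ) * evalM x r.mult * (linEval x r.e3 * linEval x r.e4)).sum := by
  unfold plusTerms
  rw [evalT_append, evalT_flatMap, evalT_flatMap]
  simp only [evalT_linTerms, evalT_pairTerms]

/-- Value of the minus side. [folklore] -/
theorem evalT_minusTerms (U : ℕ → List ℕ) (rows : List Row) (al : List ATerm) :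
    evalT x (minusTerms U rows al) =
      (al.map fun a => (a.wt : ℝ) * evalM x a.mult * linEval x (U a.ref)).sum +
        (rows.map fun r => (r.wt : ℝ) * evalM x r.mult * (linEval x r.e1 * linEval x r.e2)).sum := by
  unfold minusTerms
  rw [evalT_append, evalT_flatMap, evalT_flatMap]
  simp only [evalT_linTerms, evalT_pairTerms]

/-! ## Soundness -/

/-- Difference of two sums over the same list. [folklore] -/
theorem sum_map_sub {β : Type*} (l : List β) (f g : β → ℝ) :
    (l.map f).sum - (l.map g).sum = (l.map fun b => f b - g b).sum := by
  induction l with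
  | nil => simp
  | cons b l ih => simp only [List.map_cons, List.sum_cons]; linarith

/-- **Soundness of the checker.**  If `check L U rows al = true`, the point `x` is nonnegative and every
row holds at `x` (`E₁E₂ ≤ E₃E₄` as products of cell sums), then
`Σ_a w_a · m_a(x) · (L(x) − U_{ref a}(x)) ≤ 0`. [folklore] -/
theorem sound (hx : ∀ i, 0 ≤ x i) (L : List ℕ) (U : ℕ → List ℕ) (rows : List Row) (al : List ATerm)
    (hrows : ∀ r ∈ rows, linEval x r.e1 * linEval x r.e2 ≤ linEval x r.e3 * linEval x r.e4)
    (h : check L U rows al = true) :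
    (al.map fun a => (a.wt : ℝ) * evalM x a.mult * (linEval x L - linEval x (U a.ref))).sum ≤ 0 := by
  have hdom := evalT_le_of_dominated x hx _ _ h
  rw [evalT_normalize, evalT_normalize, evalT_plusTerms, evalT_minusTerms] at hdom
  have hR : (rows.map fun r => (r.wt : ℝ) * evalM x r.mult * (linEval x r.e1 * linEval x r.e2)).sum ≤
      (rows.map fun r => (r.wt : ℝ) * evalM x r.mult * (linEval x r.e3 * linEval x r.e4)).sum := by
    apply List.sum_le_sum
    intro r hr
    exact mul_le_mul_of_nonneg_left (hrows r hr) (mul_nonneg (Nat.cast_nonneg _) (evalM_nonneg x hx _))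
  have key : (al.map fun a => (a.wt : ℝ) * evalM x a.mult * linEval x L).sum -
      (al.map fun a => (a.wt : ℝ) * evalM x a.mult * linEval x (U a.ref)).sum ≤ 0 := by linarith
  rw [sum_map_sub] at key
  have heq : (al.map fun a => (a.wt : ℝ) * evalM x a.mult * linEval x L -
      (a.wt : ℝ) * evalM x a.mult * linEval x (U a.ref)).sum =
      (al.map fun a => (a.wt : ℝ) * evalM x a.mult * (linEval x L - linEval x (U a.ref))).sum := by
    congr 1
    refine List.map_congr_left fun a _ => ?_
    ring
  rw [heq] at key
  exact key

/-- The sum over buckets of a `0/1`-located term (helper for `evalT_eq_sum_buckets`). [folklore] -/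
theorem sum_range_ite_eq {nb k : ℕ} (c : ℝ) (hk : k < nb) :
    ((List.range nb).map fun b => if k = b then c else 0).sum = c := by
  rw [← List.sum_toFinset _ List.nodup_range, List.toFinset_range, Finset.sum_ite_eq,
    if_pos (Finset.mem_range.2 hk)]

/-- Splitting a term list into buckets: the value is the sum of the bucket values. [folklore] -/
theorem evalT_eq_sum_buckets {nb : ℕ} (hnb : 0 < nb) (l : List Term) :
    evalT x l = ((List.range nb).map fun b => evalT x (l.filter fun t => bucket nb t == b)).sum := by
  induction l with
  | nil => simp
  | cons t l ih =>
    rw [evalT_cons, ih]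
    have hb : bucket nb t < nb := Nat.mod_lt _ hnb
    -- the bucket of `t` gains the term, the others are unchanged
    have hsplit : ∀ b, evalT x ((t :: l).filter fun t' => bucket nb t' == b) =
        (if bucket nb t = b then (t.2 : ℝ) * evalM x t.1 else 0) +
          evalT x (l.filter fun t' => bucket nb t' == b) := by
      intro b
      rw [List.filter_cons]
      by_cases h : bucket nb t = b
      · simp [h, evalT_cons]
      · simp [h]
    simp only [hsplit]
    rw [List.sum_map_add]
    congr 1
    exact (sum_range_ite_eq _ hb).symm

/-- **Soundness of the bucketed checker.**  If every bucket `b < nb` passes `checkB`, the conclusion of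
`sound` holds. [folklore] -/
theorem sound_of_buckets (hx : ∀ i, 0 ≤ x i) (L : List ℕ) (U : ℕ → List ℕ) (rows : List Row)
    (al : List ATerm) {nb : ℕ} (hnb : 0 < nb)
    (hrows : ∀ r ∈ rows, linEval x r.e1 * linEval x r.e2 ≤ linEval x r.e3 * linEval x r.e4)
    (h : ∀ b < nb, checkB nb b L U rows al = true) :
    (al.map fun a => (a.wt : ℝ) * evalM x a.mult * (linEval x L - linEval x (U a.ref))).sum ≤ 0 := by
  have hdom : evalT x (plusTerms L rows al) ≤ evalT x (minusTerms U rows al) := by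
    rw [evalT_eq_sum_buckets x hnb (plusTerms L rows al), evalT_eq_sum_buckets x hnb (minusTerms U rows al)]
    apply List.sum_le_sum
    intro b hb
    have hc := h b (List.mem_range.1 hb)
    have := evalT_le_of_dominated x hx _ _ hc
    rwa [evalT_normalize, evalT_normalize] at this
  rw [evalT_plusTerms, evalT_minusTerms] at hdom
  have hR : (rows.map fun r => (r.wt : ℝ) * evalM x r.mult * (linEval x r.e1 * linEval x r.e2)).sum ≤
      (rows.map fun r => (r.wt : ℝ) * evalM x r.mult * (linEval x r.e3 * linEval x r.e4)).sum := by
    apply List.sum_le_sum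
    intro r hr
    exact mul_le_mul_of_nonneg_left (hrows r hr) (mul_nonneg (Nat.cast_nonneg _) (evalM_nonneg x hx _))
  have key : (al.map fun a => (a.wt : ℝ) * evalM x a.mult * linEval x L).sum -
      (al.map fun a => (a.wt : ℝ) * evalM x a.mult * linEval x (U a.ref)).sum ≤ 0 := by linarith
  rw [sum_map_sub] at key
  have heq : (al.map fun a => (a.wt : ℝ) * evalM x a.mult * linEval x L -
      (a.wt : ℝ) * evalM x a.mult * linEval x (U a.ref)).sum =
      (al.map fun a => (a.wt : ℝ) * evalM x a.mult * (linEval x L - linEval x (U a.ref))).sum := by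
    congr 1
    refine List.map_congr_left fun a _ => ?_
    ring
  rw [heq] at key
  exact key

/-- **From the weighted sum to one reference.**  If `Σ_a w_a m_a(x) (L − U_{ref a}) ≤ 0` and some term has
`w_a m_a(x) > 0`, then `L(x) ≤ U_{ref a}(x)` for some `a ∈ al`. [folklore] -/
theorem exists_le_of_sound (hx : ∀ i, 0 ≤ x i) (L : List ℕ) (U : ℕ → List ℕ) (al : List ATerm)
    (hsum : (al.map fun a => (a.wt : ℝ) * evalM x a.mult * (linEval x L - linEval x (U a.ref))).sum ≤ 0)
    (hpos : ∃ a ∈ al, 0 < (a.wt : ℝ) * evalM x a.mult) :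
    ∃ a ∈ al, linEval x L ≤ linEval x (U a.ref) := by
  by_contra hcon
  push Not at hcon
  obtain ⟨a₀, ha₀, hpos₀⟩ := hpos
  have hlt : 0 < (al.map fun a => (a.wt : ℝ) * evalM x a.mult * (linEval x L - linEval x (U a.ref))).sum := by
    have hnn : ∀ a ∈ al, 0 ≤ (a.wt : ℝ) * evalM x a.mult * (linEval x L - linEval x (U a.ref)) :=
      fun a ha => mul_nonneg (mul_nonneg (Nat.cast_nonneg _) (evalM_nonneg x hx _))
        (by linarith [hcon a ha])
    have hmem : (a₀.wt : ℝ) * evalM x a₀.mult * (linEval x L - linEval x (U a₀.ref)) ∈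
        al.map fun a => (a.wt : ℝ) * evalM x a.mult * (linEval x L - linEval x (U a.ref)) :=
      List.mem_map.2 ⟨a₀, ha₀, rfl⟩
    have hposterm : 0 < (a₀.wt : ℝ) * evalM x a₀.mult * (linEval x L - linEval x (U a₀.ref)) :=
      mul_pos hpos₀ (by linarith [hcon a₀ ha₀])
    exact lt_of_lt_of_le hposterm (List.single_le_sum (fun y hy => by
      obtain ⟨a, ha, rfl⟩ := List.mem_map.1 hy; exact hnn a ha) _ hmem)
  linarith

/-- Tiny self-test of the checker: `x₀ ≤ x₀ + x₁` (row-free, one multiplier). [folklore] -/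
example : check [0] (fun _ => [0, 1]) [] [⟨0, [], 1⟩] = true := by decide

end CertCheck

end Summit.CriticalPhenomena.PercolationContinuityZ3.Theorems
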